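import Summits.CriticalPhenomena.PercolationContinuityZ3.Theorems.PercNearOneGluingNoHeavyLowerTailQuantitativeS5PocketLevels
import Summits.CriticalPhenomena.PercolationContinuityZ3.Theorems.PercNearOneGluingNoHeavyLowerTailQuantitativeCshVertexFunLocus
import Summits.CriticalPhenomena.PercolationContinuityZ3.Theorems.PercNearOneGluingNoHeavyLowerTailQuantitativeS5FloorPositiveOffPocket
import Summits.CriticalPhenomena.PercolationContinuityZ3.Theorems.PercNearOneGluingNoHeavyLowerTailQuantitativeHarrisInfluenceFunctions
import Summits.CriticalPhenomena.PercolationContinuityZ3.Theorems.PercNearOneGluingNoHeavyLowerTailQuantitativeS5MarginRankFree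
import HarnessLib

/-!
# The general-`F` ZERO SET of (S5) in the pocket regime, and completeness of the explicit floor at every strictly compatible rank

Support file (`--supports stmt-CriticalPhenomena-4575`), prover seat `prim-rate-mine-2` (lane prim-rate, constants-miner (c), BENCH row
M2-R40; `run/shared/lean/prim/prim-rate/prim-rate-mine-2/PROOFS.md` §P40).  No definitions, no named facts, no sorries; standard axioms.

Weights non-degenerate on their support `E` (`w = 0` off `E`, `0 < w < 1` on `E`); relays `T` with an injective rank `r`, minimal relay `x₁`;
observers `o ≠ v` off `T`; `F` monotone nonnegative on vertex sets.  The POCKET REGIME: every relay adjacent in `E` to the observer's pocket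
`{y | o ⇝ y through pairs of E missing T ∪ {v}}` is `x₁`.  There the (S5) margin is the sum of its decoy-free level margins
(`CSH.s5dMargin_nil_eq_sum_levels_of_forall_not_adj`), each `≥ 0` with the exact zero locus of `CSH.cshMargin_nil_pos_iff_exists_pivotal_vertexFun`:

* `CSH.s5dMargin_nil_pos_iff_exists_level_pivotal` — pocket regime: **`0 < s5dMargin w T r [] o v F` iff at SOME level `a ∈ T` some pair of `E`
  missing `T_{<a}` is pivotal inside `E − pairs(T_{<a})` both for `F(V(𝒞_a))` and for `{o ↔ a} ∪ {o ↔ v}`** (the general-`F` zero set of (S5));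
* `CSH.floor_pos_of_forall_not_adj` — pocket regime, `r` compatible (ties allowed): `0 < s5dMargin … F` ⟹ the explicit floor of
  `CSH.s5dMargin_ge_sum_rankGain_add_isolatedFloor_of_lt_one_of_compat` is positive AT `r` (its isolated Harris term at the positive level is,
  by `QuantHarris.cov_pos_iff_exists_influence`: in the pocket a pair pivotal for `{o ↔ a} ∪ {o ↔ v}` is pivotal for the floor's event
  `{o ↔ {a} ∪ T_{>a}} ∪ {o ↔ v}`, `CSH.exists_exit_of_walk`);
* `CSH.s5dMargin_nil_pos_iff_floor_pos_of_strict` — support on which every relay is joined to `x₁`, `r` STRICTLY compatible: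
  **`0 < s5dMargin w T r [] o v F ↔ 0 < FLOOR_F(r)`** (pocket regime: the previous theorem; otherwise `CSH.floor_pos_of_adj`) — row M2-R30 ⟹ at
  every strictly compatible injective rank, with the rank itself as the witness (`CSH.s5dMargin_nil_pos_iff_exists_rank_floor_pos_of_strict`).
[cite: KozmaNitzan2024, Conj. 4 (p. 32)] [cite: Harris1960, Lemma 4.1 (p. 16)] [cite: VandenbergHaggstromKahn2005, §2.1 (pp. 9–13)]
-/

noncomputable section

namespace Summit.CriticalPhenomena.PercolationContinuityZ3.Theorems

open MeasureTheory Set Literature.Probability.LatticeModels Literature.Probability.Percolation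
open scoped Classical
open KNPreFKG

namespace CSH

variable {n : ℕ}

/-- A walk of `ω ⊆ E` from inside a pocket `K` (whose `E`-exits end at `v` or `x₁`) to a vertex outside `K` passes an exit: some pair
`s(p, q) ∈ ω` with `p ∈ K`, `q ∈ {v, x₁}`, and `q` reached from the start. [folklore] -/
theorem exists_exit_of_walk {V : Type*} {E ω : Set (Sym2 V)} (hωE : ω ⊆ E) {K : Set V} {v x₁ : V}
    (hK : ∀ p q : V, s(p, q) ∈ E → p ∈ K → q ∈ K ∨ q = v ∨ q = x₁) :
    ∀ {u t : V} (W : (openGraph ω).Walk u t), u ∈ K → t ∉ K →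
      ∃ p q : V, p ∈ K ∧ (q = v ∨ q = x₁) ∧ s(p, q) ∈ ω ∧ (openGraph ω).Reachable u q := by
  intro u t W
  induction W with
  | nil => intro hu ht; exact absurd hu ht
  | @cons u u₁ t hadj W' ih =>
    intro hu ht
    have he : s(u, u₁) ∈ ω ∧ u ≠ u₁ := by rw [openGraph, SimpleGraph.fromEdgeSet_adj] at hadj; exact hadj
    by_cases hu₁ : u₁ ∈ K
    · obtain ⟨p, q, hp, hq, hpq, hreach⟩ := ih hu₁ ht
      exact ⟨p, q, hp, hq, hpq, hadj.reachable.trans hreach⟩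
    · rcases hK u u₁ (hωE he.1) hu with h | h | h
      · exact absurd h hu₁
      · exact ⟨u, u₁, hu, Or.inl h, he.1, hadj.reachable⟩
      · exact ⟨u, u₁, hu, Or.inr h, he.1, hadj.reachable⟩

/-- **The general-`F` ZERO SET of (S5) in the pocket regime.**  Weights non-degenerate on their support `E`; `o ≠ v` off `T`; `r` injective on
`T` with minimal relay `x₁ ∈ T`; every relay adjacent in `E` to the observer's pocket is `x₁`; `F` monotone nonnegative.  Then
`0 < s5dMargin w T r [] o v F` iff for some `a ∈ T` some pair `e ∈ E` missing `T_{<a}` is pivotal, at configurations inside `E − pairs(T_{<a})`,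
both for `F(V(𝒞_a))` and for `{o ↔ a} ∪ {o ↔ v}`. [cite: KozmaNitzan2024, Conj. 4 (p. 32)] [cite: Harris1960, Lemma 4.1 (p. 16)] -/
theorem s5dMargin_nil_pos_iff_exists_level_pivotal (w : Sym2 (Fin n) → unitInterval) (E : Set (Sym2 (Fin n)))
    (hE0 : ∀ f, f ∉ E → (w f : ℝ) = 0) (hE1 : ∀ f ∈ E, 0 < (w f : ℝ) ∧ (w f : ℝ) < 1)
    (T : Finset (Fin n)) (r : Fin n → ℕ) (hr : Set.InjOn r ↑T) (x₁ : Fin n) (hx : x₁ ∈ T) (hmin : ∀ t ∈ T, r x₁ ≤ r t)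
    (o v : Fin n) (hoT : o ∉ T) (hvT : v ∉ T) (hov : o ≠ v)
    (hpocket : ∀ y b : Fin n,
      (openGraph {f | f ∈ E ∧ ∀ z ∈ f, z ∉ T ∧ z ≠ v}).Reachable o y → b ∈ T → s(y, b) ∈ E → b = x₁)
    (F : Set (Fin n) → ℝ) (hF : ∀ S S' : Set (Fin n), S ⊆ S' → F S ≤ F S') (hF0 : ∀ S : Set (Fin n), 0 ≤ F S) :
    0 < s5dMargin w T r [] o v F ↔
      ∃ a ∈ T, ∃ e ∈ E, (∀ y ∈ (↑(T.filter (fun t => r t < r a)) : Set (Fin n)), y ∉ e) ∧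
        (∃ η : Set (Sym2 (Fin n)), η ⊆ {f | f ∈ E ∧ ∀ y ∈ (↑(T.filter (fun t => r t < r a)) : Set (Fin n)), y ∉ f} ∧
          F {c | c = a ∨ ∃ e' ∈ openEdgeCluster (η \ {e}) a, c ∈ e'} <
            F {c | c = a ∨ ∃ e' ∈ openEdgeCluster (insert e η) a, c ∈ e'}) ∧
        (∃ η : Set (Sym2 (Fin n)), η ⊆ {f | f ∈ E ∧ ∀ y ∈ (↑(T.filter (fun t => r t < r a)) : Set (Fin n)), y ∉ f} ∧
          insert e η ∈ (openConn o a ∪ openConn o v : Set (BondConfig (Fin n))) ∧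
          η \ {e} ∉ (openConn o a ∪ openConn o v : Set (BondConfig (Fin n)))) := by
  have hw1r : ∀ e, (w e : ℝ) < 1 := by
    intro e
    by_cases he : e ∈ E
    · exact (hE1 e he).2
    · rw [hE0 e he]; norm_num
  have hw : ∀ e, w e < 1 := fun e => by
    have h := hw1r e
    exact Subtype.coe_lt_coe.1 (by simpa using h)
  rw [s5dMargin_nil_eq_sum_levels_of_forall_not_adj w hw E hE0 T r hr x₁ hx hmin o v hoT hvT hov hpocket F]
  -- every level is a decoy-free CSH margin `≥ 0` over a positive normalisation
  have hside : ∀ a ∈ T, a ∉ (↑(T.filter (fun t => r t < r a)) : Set (Fin n)) ∧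
      o ∉ (↑(T.filter (fun t => r t < r a)) : Set (Fin n)) ∧ v ∉ (↑(T.filter (fun t => r t < r a)) : Set (Fin n)) ∧ o ≠ a ∧ v ≠ a := by
    intro a ha
    refine ⟨fun h => ?_, fun h => hoT (Finset.mem_filter.1 (Finset.mem_coe.1 h)).1,
      fun h => hvT (Finset.mem_filter.1 (Finset.mem_coe.1 h)).1, fun h => hoT (h ▸ ha), fun h => hvT (h ▸ ha)⟩
    exact lt_irrefl _ (Finset.mem_filter.1 (Finset.mem_coe.1 h)).2
  have hden : ∀ a ∈ T, 0 < (prodBernoulli w).real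
      {ω : BondConfig (Fin n) | ∀ t ∈ (↑(T.filter (fun t => r t < r a)) : Set (Fin n)), ¬ (openGraph ω).Reachable a t} := by
    intro a ha
    refine prodBernoulli_real_pos_of_empty_mem w hw fun t ht h => ?_
    rw [HullPort.reachable_empty_iff] at h
    exact (hside a ha).1 (h ▸ ht)
  have hnum : ∀ a ∈ T, 0 ≤ cshMargin w a (↑(T.filter (fun t => r t < r a)) : Set (Fin n)) [] o v
      (fun C => F {c | c = a ∨ ∃ e ∈ C, c ∈ e}) := by
    intro a ha
    obtain ⟨haY, hoY, hvY, hoa, hva⟩ := hside a ha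
    exact cshAll_of_lt_one n w hw o v a (T.filter (fun t => r t < r a)) [] hov (fun h => haY (Finset.mem_coe.2 h)) hoa hva
      (fun h => hoY (Finset.mem_coe.2 h)) (fun h => hvY (Finset.mem_coe.2 h)) List.nodup_nil (fun d hd => absurd hd List.not_mem_nil)
      _ (monotone_clusterFun a F hF)
  have hterm : ∀ a ∈ T, 0 ≤ cshMargin w a (↑(T.filter (fun t => r t < r a)) : Set (Fin n)) [] o v
      (fun C => F {c | c = a ∨ ∃ e ∈ C, c ∈ e}) /
      (prodBernoulli w).real
        {ω : BondConfig (Fin n) | ∀ t ∈ (↑(T.filter (fun t => r t < r a)) : Set (Fin n)), ¬ (openGraph ω).Reachable a t} :=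
    fun a ha => div_nonneg (hnum a ha) (hden a ha).le
  rw [Finset.sum_pos_iff_of_nonneg hterm]
  constructor
  · rintro ⟨a, ha, hlt⟩
    obtain ⟨haY, hoY, hvY, hoa, hva⟩ := hside a ha
    exact ⟨a, ha, (cshMargin_nil_pos_iff_exists_pivotal_vertexFun w E hE0 hE1 a _ o v haY hoa hva hoY hvY hov F hF hF0).1
      ((div_pos_iff_of_pos_right (hden a ha)).1 hlt)⟩
  · rintro ⟨a, ha, hcrit⟩
    obtain ⟨haY, hoY, hvY, hoa, hva⟩ := hside a ha
    exact ⟨a, ha, (div_pos_iff_of_pos_right (hden a ha)).2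
      ((cshMargin_nil_pos_iff_exists_pivotal_vertexFun w E hE0 hE1 a _ o v haY hoa hva hoY hvY hov F hF hF0).2 hcrit)⟩

/-- **Row M2-R30 ⟹ in the pocket regime, with the rank itself as the witness and no strictness.**  Weights non-degenerate on their support `E`;
`o ≠ v` off `T`; `r` injective on `T`, minimal relay `x₁`, compatible with the means of the monotone nonnegative `F` (ties allowed); every relay
adjacent in `E` to the observer's pocket is `x₁`.  If `0 < s5dMargin w T r [] o v F` then the explicit floor of
`CSH.s5dMargin_ge_sum_rankGain_add_isolatedFloor_of_lt_one_of_compat` is positive at `r`: the isolated Harris term of the positive level is.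
[cite: KozmaNitzan2024, Conj. 4 (p. 32)] [cite: Harris1960, Lemma 4.1 (p. 16)] -/
theorem floor_pos_of_forall_not_adj (w : Sym2 (Fin n) → unitInterval) (E : Set (Sym2 (Fin n)))
    (hE0 : ∀ f, f ∉ E → (w f : ℝ) = 0) (hE1 : ∀ f ∈ E, 0 < (w f : ℝ) ∧ (w f : ℝ) < 1)
    (T : Finset (Fin n)) (r : Fin n → ℕ) (hr : Set.InjOn r ↑T) (x₁ : Fin n) (hx : x₁ ∈ T) (hmin : ∀ t ∈ T, r x₁ ≤ r t)
    (o v : Fin n) (hoT : o ∉ T) (hvT : v ∉ T) (hov : o ≠ v)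
    (hpocket : ∀ y b : Fin n,
      (openGraph {f | f ∈ E ∧ ∀ z ∈ f, z ∉ T ∧ z ≠ v}).Reachable o y → b ∈ T → s(y, b) ∈ E → b = x₁)
    (F : Set (Fin n) → ℝ) (hF : ∀ S S' : Set (Fin n), S ⊆ S' → F S ≤ F S') (hF0 : ∀ S : Set (Fin n), 0 ≤ F S)
    (hcompat : ∀ a ∈ T, ∀ a' ∈ T, r a < r a' →
      ∫ ω, F (openCluster ω a) ∂(prodBernoulli w) ≤ ∫ ω, F (openCluster ω a') ∂(prodBernoulli w))
    (hpos : 0 < s5dMargin w T r [] o v F) :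
    0 < ∑ a ∈ T, (rankGain w T r F a * avoidConst w a ((↑(T.erase a) : Set (Fin n)) ∪ ({d | d ∈ ([] : List (Fin n))} ∪ {v})) o +
        (∏ e ∈ Finset.univ.filter (fun e : Sym2 (Fin n) => ∃ y ∈ (↑(T.filter (fun b => r b < r a)) : Set (Fin n)), y ∈ e), (1 - (w e : ℝ))) *
          ((∫ η in ((⋃ t ∈ (insert a (T.filter (fun b => r a < r b) ∪ ([] : List (Fin n)).toFinset)), openConn o t) ∪ openConn o v),
              F {c | c = a ∨ ∃ e ∈ openEdgeCluster η a, c ∈ e}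
              ∂(prodBernoulli fun e => if (∃ y ∈ (↑(T.filter (fun b => r b < r a)) : Set (Fin n)), y ∈ e) then (0 : unitInterval) else w e)) -
            (prodBernoulli fun e => if (∃ y ∈ (↑(T.filter (fun b => r b < r a)) : Set (Fin n)), y ∈ e) then (0 : unitInterval) else w e).real
                ((⋃ t ∈ (insert a (T.filter (fun b => r a < r b) ∪ ([] : List (Fin n)).toFinset)), openConn o t) ∪ openConn o v) *
              (∫ η, F {c | c = a ∨ ∃ e ∈ openEdgeCluster η a, c ∈ e}
                ∂(prodBernoulli fun e => if (∃ y ∈ (↑(T.filter (fun b => r b < r a)) : Set (Fin n)), y ∈ e) then (0 : unitInterval) else w e)))) := by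
  have hmeas : ∀ S : Set (BondConfig (Fin n)), MeasurableSet S := fun _ => MeasurableSet.of_discrete
  have hw1r : ∀ e, (w e : ℝ) < 1 := by
    intro e
    by_cases he : e ∈ E
    · exact (hE1 e he).2
    · rw [hE0 e he]; norm_num
  obtain ⟨a, ha, e, heE, heY, ⟨η, hηEY, hFlt⟩, ⟨η', hη'EY, hU1, hU0⟩⟩ :=
    (s5dMargin_nil_pos_iff_exists_level_pivotal w E hE0 hE1 T r hr x₁ hx hmin o v hoT hvT hov hpocket F hF hF0).1 hpos
  -- the canonical pocket and its exits
  set K : Set (Fin n) := {y | (openGraph {f | f ∈ E ∧ ∀ z ∈ f, z ∉ T ∧ z ≠ v}).Reachable o y} with hKdef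
  have hKprop : ∀ y ∈ K, y ∉ T ∧ y ≠ v := by
    intro y hy
    exact forall_reachable_of_edges (S := {f | f ∈ E ∧ ∀ z ∈ f, z ∉ T ∧ z ≠ v}) (fun z => z ∉ T ∧ z ≠ v) ⟨hoT, hov⟩
      (fun f hf z hz => hf.2 z hz) hy
  have hoK : o ∈ K := SimpleGraph.Reachable.refl _
  have hK : ∀ p q : Fin n, s(p, q) ∈ E → p ∈ K → q ∈ K ∨ q = v ∨ q = x₁ := by
    intro p q hpq hp
    by_cases hqv : q = v
    · exact Or.inr (Or.inl hqv)
    by_cases hqT : q ∈ T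
    · exact Or.inr (Or.inr (hpocket p q hp hqT hpq))
    by_cases hpq' : p = q
    · exact Or.inl (hpq' ▸ hp)
    left
    have hadj : (openGraph {f | f ∈ E ∧ ∀ z ∈ f, z ∉ T ∧ z ≠ v}).Adj p q := by
      rw [openGraph_adj]
      refine ⟨⟨hpq, fun z hz => ?_⟩, hpq'⟩
      rcases Sym2.mem_iff.1 hz with rfl | rfl
      · exact hKprop _ hp
      · exact ⟨hqT, hqv⟩
    exact SimpleGraph.Reachable.trans hp hadj.reachable
  -- the objects of the isolated Harris term at `a`
  set Y : Set (Fin n) := (↑(T.filter (fun b => r b < r a)) : Set (Fin n)) with hY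
  set U : Set (BondConfig (Fin n)) :=
    (⋃ t ∈ (insert a (T.filter (fun b => r a < r b) ∪ ([] : List (Fin n)).toFinset)), openConn o t) ∪ openConn o v with hU
  set qY : Sym2 (Fin n) → unitInterval := fun e => if (∃ y ∈ Y, y ∈ e) then (0 : unitInterval) else w e with hqY
  set EY : Set (Sym2 (Fin n)) := {f | f ∈ E ∧ ∀ y ∈ Y, y ∉ f} with hEY
  set f : BondConfig (Fin n) → ℝ := fun ζ => F {c | c = a ∨ ∃ e ∈ openEdgeCluster ζ a, c ∈ e} with hfdef
  have hUup : ∀ ω ω' : BondConfig (Fin n), ω ⊆ ω' → ω ∈ U → ω' ∈ U := by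
    rintro ω ω' hle (h | h)
    · obtain ⟨t, ht, h⟩ := Set.mem_iUnion₂.1 h
      exact Or.inl (Set.mem_iUnion₂.2 ⟨t, ht, SimpleGraph.Reachable.mono (BHK2006.openGraph_le hle) h⟩)
    · exact Or.inr (SimpleGraph.Reachable.mono (BHK2006.openGraph_le hle) h)
  have hfmono : Monotone f := fun _ _ h => (monotone_clusterFun a F hF) (BHK2006.openEdgeCluster_mono h a)
  have hf0 : ∀ ζ, 0 ≤ f ζ := fun _ => hF0 _
  -- the zeroed weights are non-degenerate exactly on `EY`
  have hq0 : ∀ e, e ∉ EY → ((qY e : unitInterval) : ℝ) = 0 := by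
    intro e he
    simp only [hqY]
    by_cases hc : ∃ y ∈ Y, y ∈ e
    · rw [if_pos hc]; rfl
    · rw [if_neg hc]
      apply hE0 e
      intro heE
      exact he ⟨heE, fun y hy hye => hc ⟨y, hy, hye⟩⟩
  have hq1 : ∀ e ∈ EY, 0 < ((qY e : unitInterval) : ℝ) ∧ ((qY e : unitInterval) : ℝ) < 1 := by
    intro e he
    have hc : ¬ ∃ y ∈ Y, y ∈ e := by
      rintro ⟨y, hy, hye⟩
      exact he.2 y hy hye
    simp only [hqY]
    rw [if_neg hc]
    exact hE1 e he.1
  -- (1) in the pocket, `e` is pivotal for the floor's event `U` at `η'`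
  have hU1' : insert e η' ∈ U := by
    rcases hU1 with h | h
    · exact Or.inl (Set.mem_iUnion₂.2 ⟨a, Finset.mem_insert_self _ _, h⟩)
    · exact Or.inr h
  have hU0' : η' \ {e} ∉ U := by
    intro hmem
    have hωE : η' \ {e} ⊆ E := fun g hg => (hη'EY hg.1).1
    have hωY : ∀ g ∈ η' \ {e}, ∀ y ∈ Y, y ∉ g := fun g hg => (hη'EY hg.1).2
    rcases hmem with h | h
    · obtain ⟨t, ht, hot⟩ := Set.mem_iUnion₂.1 h
      rcases Finset.mem_insert.1 ht with rfl | ht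
      · exact hU0 (Or.inl hot)
      · have htT : t ∈ T := by
          rcases Finset.mem_union.1 ht with ht | ht
          · exact (Finset.mem_filter.1 ht).1
          · simp at ht
        have htK : t ∉ K := fun h => (hKprop t h).1 htT
        obtain ⟨W⟩ := hot
        obtain ⟨p, q, hp, hq, hpq, hreach⟩ := exists_exit_of_walk hωE hK W hoK htK
        rcases hq with hq | hq
        · rw [hq] at hreach
          exact hU0 (Or.inr hreach)
        · -- a pair into `x₁` lies in `EY` only if `x₁ ∉ T_{<a}`, i.e. `x₁ = a`
          rw [hq] at hpq hreach
          have hx₁Y : x₁ ∉ Y := fun h => hωY _ hpq x₁ h (Sym2.mem_mk_right _ _)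
          have hxa : x₁ = a := by
            by_contra hne
            refine hx₁Y ?_
            rw [hY, Finset.mem_coe, Finset.mem_filter]
            exact ⟨hx, lt_of_le_of_ne (hmin a ha) fun h => hne (hr hx ha h)⟩
          rw [hxa] at hreach
          exact hU0 (Or.inl hreach)
    · exact hU0 (Or.inr h)
  -- (2) the equality case of Harris for functions: the isolated covariance is positive
  have hcov := (QuantHarris.cov_pos_iff_exists_influence qY EY hq0 hq1 f (U.indicator fun _ => (1 : ℝ)) hf0
    (fun ω => Set.indicator_nonneg (fun _ _ => zero_le_one) ω) hfmono (QuantHarris.indicator_upset_monotone hUup)).2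
    ⟨e, ⟨heE, heY⟩, ⟨η, hηEY, by simp only [hfdef]; exact hFlt.ne'⟩,
      ⟨η', hη'EY, by rw [Set.indicator_of_mem hU1', Set.indicator_of_notMem hU0']; exact one_ne_zero⟩⟩
  have hprod : (fun ζ => f ζ * U.indicator (fun _ => (1 : ℝ)) ζ) = U.indicator f := by
    funext ζ
    by_cases hζ : ζ ∈ U
    · rw [Set.indicator_of_mem hζ, Set.indicator_of_mem hζ, mul_one]
    · rw [Set.indicator_of_notMem hζ, Set.indicator_of_notMem hζ, mul_zero]
  rw [hprod, integral_indicator (hmeas U), integral_indicator (hmeas U)] at hcov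
  simp only [integral_const, smul_eq_mul, mul_one, measureReal_restrict_apply_univ] at hcov
  have hiso : 0 < (∫ ζ in U, f ζ ∂(prodBernoulli qY)) - (prodBernoulli qY).real U * ∫ ζ, f ζ ∂(prodBernoulli qY) := by
    linarith [hcov, mul_comm ((prodBernoulli qY).real U) (∫ ζ, f ζ ∂(prodBernoulli qY))]
  have hprodpos : 0 < ∏ e ∈ Finset.univ.filter (fun e : Sym2 (Fin n) => ∃ y ∈ Y, y ∈ e), (1 - (w e : ℝ)) :=
    Finset.prod_pos fun e _ => by linarith [hw1r e]
  -- (3) the floor dominates its `a`-summand, whose isolated part is positive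
  have hnn := fun a' (ha' : a' ∈ T) => isolatedFloor_term_nonneg w o v T r F hF hF0 hcompat a' ha'
  have hsingle := Finset.single_le_sum (fun a' ha' => add_nonneg (hnn a' ha').1 (hnn a' ha').2) ha
  have hterm : 0 < (∏ e ∈ Finset.univ.filter (fun e : Sym2 (Fin n) => ∃ y ∈ Y, y ∈ e), (1 - (w e : ℝ))) *
      ((∫ ζ in U, f ζ ∂(prodBernoulli qY)) - (prodBernoulli qY).real U * ∫ ζ, f ζ ∂(prodBernoulli qY)) := mul_pos hprodpos hiso
  simp only [hY, hU, hqY, hfdef] at hterm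
  linarith [(hnn a ha).1, hsingle, hterm]

/-- **Completeness of the explicit general-`F` floor at every STRICTLY compatible rank** (row M2-R30 ⟹ with `r' = r`).  Weights
non-degenerate on a support `E` in which every relay is joined to the minimal relay `x₁`; `o ≠ v` off `T`; `r` injective on `T`, strictly
compatible with the means of the monotone nonnegative `F`.  Then `0 < s5dMargin w T r [] o v F ↔ 0 < FLOOR_F(r)` (⟸ is the kernel floor;
⟹: pocket regime by `floor_pos_of_forall_not_adj`, otherwise `floor_pos_of_adj`). [cite: KozmaNitzan2024, Conj. 4 (p. 32)]
[cite: Harris1960, Lemma 4.1 (p. 16)] -/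
theorem s5dMargin_nil_pos_iff_floor_pos_of_strict (w : Sym2 (Fin n) → unitInterval) (E : Set (Sym2 (Fin n)))
    (hE0 : ∀ f, f ∉ E → (w f : ℝ) = 0) (hE1 : ∀ f ∈ E, 0 < (w f : ℝ) ∧ (w f : ℝ) < 1)
    (T : Finset (Fin n)) (r : Fin n → ℕ) (hr : Set.InjOn r ↑T) (x₁ : Fin n) (hx : x₁ ∈ T) (hmin : ∀ t ∈ T, r x₁ ≤ r t)
    (hconn : ∀ b ∈ T, (openGraph E).Reachable b x₁)
    (o v : Fin n) (hoT : o ∉ T) (hvT : v ∉ T) (hov : o ≠ v)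
    (F : Set (Fin n) → ℝ) (hF : ∀ S S' : Set (Fin n), S ⊆ S' → F S ≤ F S') (hF0 : ∀ S : Set (Fin n), 0 ≤ F S)
    (hstrict : ∀ a ∈ T, ∀ a' ∈ T, r a < r a' →
      ∫ ω, F (openCluster ω a) ∂(prodBernoulli w) < ∫ ω, F (openCluster ω a') ∂(prodBernoulli w)) :
    0 < s5dMargin w T r [] o v F ↔ 0 < ∑ a ∈ T, (rankGain w T r F a * avoidConst w a ((↑(T.erase a) : Set (Fin n)) ∪ ({d | d ∈ ([] : List (Fin n))} ∪ {v})) o +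
        (∏ e ∈ Finset.univ.filter (fun e : Sym2 (Fin n) => ∃ y ∈ (↑(T.filter (fun b => r b < r a)) : Set (Fin n)), y ∈ e), (1 - (w e : ℝ))) *
          ((∫ η in ((⋃ t ∈ (insert a (T.filter (fun b => r a < r b) ∪ ([] : List (Fin n)).toFinset)), openConn o t) ∪ openConn o v),
              F {c | c = a ∨ ∃ e ∈ openEdgeCluster η a, c ∈ e}
              ∂(prodBernoulli fun e => if (∃ y ∈ (↑(T.filter (fun b => r b < r a)) : Set (Fin n)), y ∈ e) then (0 : unitInterval) else w e)) -
            (prodBernoulli fun e => if (∃ y ∈ (↑(T.filter (fun b => r b < r a)) : Set (Fin n)), y ∈ e) then (0 : unitInterval) else w e).real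
                ((⋃ t ∈ (insert a (T.filter (fun b => r a < r b) ∪ ([] : List (Fin n)).toFinset)), openConn o t) ∪ openConn o v) *
              (∫ η, F {c | c = a ∨ ∃ e ∈ openEdgeCluster η a, c ∈ e}
                ∂(prodBernoulli fun e => if (∃ y ∈ (↑(T.filter (fun b => r b < r a)) : Set (Fin n)), y ∈ e) then (0 : unitInterval) else w e)))) := by
  have hcompat : ∀ a ∈ T, ∀ a' ∈ T, r a < r a' →
      ∫ ω, F (openCluster ω a) ∂(prodBernoulli w) ≤ ∫ ω, F (openCluster ω a') ∂(prodBernoulli w) :=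
    fun a ha a' ha' hlt => (hstrict a ha a' ha' hlt).le
  have hw1r : ∀ e, (w e : ℝ) < 1 := by
    intro e
    by_cases he : e ∈ E
    · exact (hE1 e he).2
    · rw [hE0 e he]; norm_num
  have hw : ∀ e, w e < 1 := fun e => by
    have h := hw1r e
    exact Subtype.coe_lt_coe.1 (by simpa using h)
  constructor
  · intro hpos
    by_cases hp : ∀ y b : Fin n, (openGraph {f | f ∈ E ∧ ∀ z ∈ f, z ∉ T ∧ z ≠ v}).Reachable o y → b ∈ T → s(y, b) ∈ E → b = x₁
    · exact floor_pos_of_forall_not_adj w E hE0 hE1 T r hr x₁ hx hmin o v hoT hvT hov hp F hF hF0 hcompat hpos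
    · push Not at hp
      obtain ⟨y, b, hy, hb, hyb, hbx⟩ := hp
      exact floor_pos_of_adj w E hE0 hE1 T r hr x₁ hx hmin o v hoT hvT hov y b hy hb hbx hyb (hconn b hb) F hF hF0 hstrict
  · intro hfloor
    exact lt_of_lt_of_le hfloor
      (s5dMargin_ge_sum_rankGain_add_isolatedFloor_of_lt_one_of_compat w hw o v hov T r F hF hF0 hr hcompat hoT hvT)

/-- **Row M2-R30 ⟹ ⟸ AS TYPED, at every strictly compatible rank.**  Under the hypotheses of `s5dMargin_nil_pos_iff_floor_pos_of_strict`: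
`0 < s5dMargin w T r [] o v F ↔ ∃ r'` injective on `T`, compatible with the means of `F`, with `0 < FLOOR_F(r')` (⟹: `r' = r`; ⟸: the kernel
floor at `r'` and rank-freeness of the margin `CSH.s5dMargin_nil_eq_of_compat`). [cite: KozmaNitzan2024, Conj. 4 (p. 32)] -/
theorem s5dMargin_nil_pos_iff_exists_rank_floor_pos_of_strict (w : Sym2 (Fin n) → unitInterval) (E : Set (Sym2 (Fin n)))
    (hE0 : ∀ f, f ∉ E → (w f : ℝ) = 0) (hE1 : ∀ f ∈ E, 0 < (w f : ℝ) ∧ (w f : ℝ) < 1)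
    (T : Finset (Fin n)) (r : Fin n → ℕ) (hr : Set.InjOn r ↑T) (x₁ : Fin n) (hx : x₁ ∈ T) (hmin : ∀ t ∈ T, r x₁ ≤ r t)
    (hconn : ∀ b ∈ T, (openGraph E).Reachable b x₁)
    (o v : Fin n) (hoT : o ∉ T) (hvT : v ∉ T) (hov : o ≠ v)
    (F : Set (Fin n) → ℝ) (hF : ∀ S S' : Set (Fin n), S ⊆ S' → F S ≤ F S') (hF0 : ∀ S : Set (Fin n), 0 ≤ F S)
    (hstrict : ∀ a ∈ T, ∀ a' ∈ T, r a < r a' →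
      ∫ ω, F (openCluster ω a) ∂(prodBernoulli w) < ∫ ω, F (openCluster ω a') ∂(prodBernoulli w)) :
    0 < s5dMargin w T r [] o v F ↔
      ∃ r' : Fin n → ℕ, Set.InjOn r' ↑T ∧
        (∀ a ∈ T, ∀ a' ∈ T, r' a < r' a' →
          ∫ ω, F (openCluster ω a) ∂(prodBernoulli w) ≤ ∫ ω, F (openCluster ω a') ∂(prodBernoulli w)) ∧
        0 < ∑ a ∈ T, (rankGain w T r' F a * avoidConst w a ((↑(T.erase a) : Set (Fin n)) ∪ ({d | d ∈ ([] : List (Fin n))} ∪ {v})) o +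
        (∏ e ∈ Finset.univ.filter (fun e : Sym2 (Fin n) => ∃ y ∈ (↑(T.filter (fun b => r' b < r' a)) : Set (Fin n)), y ∈ e), (1 - (w e : ℝ))) *
          ((∫ η in ((⋃ t ∈ (insert a (T.filter (fun b => r' a < r' b) ∪ ([] : List (Fin n)).toFinset)), openConn o t) ∪ openConn o v),
              F {c | c = a ∨ ∃ e ∈ openEdgeCluster η a, c ∈ e}
              ∂(prodBernoulli fun e => if (∃ y ∈ (↑(T.filter (fun b => r' b < r' a)) : Set (Fin n)), y ∈ e) then (0 : unitInterval) else w e)) -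
            (prodBernoulli fun e => if (∃ y ∈ (↑(T.filter (fun b => r' b < r' a)) : Set (Fin n)), y ∈ e) then (0 : unitInterval) else w e).real
                ((⋃ t ∈ (insert a (T.filter (fun b => r' a < r' b) ∪ ([] : List (Fin n)).toFinset)), openConn o t) ∪ openConn o v) *
              (∫ η, F {c | c = a ∨ ∃ e ∈ openEdgeCluster η a, c ∈ e}
                ∂(prodBernoulli fun e => if (∃ y ∈ (↑(T.filter (fun b => r' b < r' a)) : Set (Fin n)), y ∈ e) then (0 : unitInterval) else w e)))) := by
  have hcompat : ∀ a ∈ T, ∀ a' ∈ T, r a < r a' →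
      ∫ ω, F (openCluster ω a) ∂(prodBernoulli w) ≤ ∫ ω, F (openCluster ω a') ∂(prodBernoulli w) :=
    fun a ha a' ha' hlt => (hstrict a ha a' ha' hlt).le
  have hw1r : ∀ e, (w e : ℝ) < 1 := by
    intro e
    by_cases he : e ∈ E
    · exact (hE1 e he).2
    · rw [hE0 e he]; norm_num
  have hw : ∀ e, w e < 1 := fun e => by
    have h := hw1r e
    exact Subtype.coe_lt_coe.1 (by simpa using h)
  constructor
  · intro hpos
    exact ⟨r, hr, hcompat, (s5dMargin_nil_pos_iff_floor_pos_of_strict w E hE0 hE1 T r hr x₁ hx hmin hconn o v hoT hvT hov F hF hF0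
      hstrict).1 hpos⟩
  · rintro ⟨r', hr', hcompat', hfloor⟩
    have hle := s5dMargin_ge_sum_rankGain_add_isolatedFloor_of_lt_one_of_compat w hw o v hov T r' F hF hF0 hr' hcompat' hoT hvT
    rw [s5dMargin_nil_eq_of_compat w T r r' o v F hr hr' hcompat hcompat']
    exact lt_of_lt_of_le hfloor hle

end CSH

end Summit.CriticalPhenomena.PercolationContinuityZ3.Theorems

end
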